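import Literature.MathematicalPhysics.QuantumFieldTheory.Balaban1983to89.B6Cover236MultiLevelTorusBlocksL0
/-!
# `Balaban1983to89.B6Cover236MultiLevelTorusReachL0` — LEVEL-0 TWIN (programme G-F3′-L0, director-ym LINE №27 / UV3-NODE §24.5; plan `lit-balaban-r03/G-F3L0-PLAN.md`) of `B6Cover236MultiLevelTorusReach`:
the same declarations, SAME NAMES AND STATEMENTS, for nested families WITH print's region `Λ₀ = T ∖ Ω₁` ADMITTED (structures
`B6MultiLevelBoxOperatorL0.Domains` / `B6MultiLevelTorusOperatorL0.TDomains`: levels `0, …, k`, the level-`0` block a single site, `Q′₀ = id`,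
finite weight `a₀` — print p.225 (2.14) «Σ_{j=0}^k … (Q′₀λ)(x) = λ(x), x ∈ Λ₀», p.229 «taking a sequence (2.1) … smallest possible domains B^j(Λ_j),
and considering the operator Δ_a defined by (2.19), (2.20) for this sequence»).  Every `D`-free object is the lineage's, consumed BY NAME; no existing
module is touched; no fact is minted.  Unit `lit-balaban-r03` (B6 fold owner, r03 gen 36); referee ref-4.  THE TWIN'S DOCUMENTATION FOLLOWS
VERBATIM (its «levels 1 … k» / «Ω₁ = X» sentences describe the twin; here `j` runs from `0` and `Ω₁` may be a proper subset).

# `Balaban1983to89.B6Cover236MultiLevelTorusReach` — THE FINITE OVERLAP OF THE REACH SETS `□⁺ = QT □` OF THE k-LEVEL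
PERIODIC PARTITION ON THE TORUS `T_η`: every torus block belongs to at most `3·5^{d+1}` of the enlarged cubes `□⁺`
(a leaf next to `B6Cover236MultiLevelTorusBlocks` §2; no existing module is touched; no fact is minted)

FRAMING (verbatim cell line):
statement-level skeleton of published theorems with citation tags; proofs where landed; nothing here is a claim about the Yang–Mills mass gap

Source under audit (cell pub-balaban / lit-balaban): T. Bałaban, *Propagators and renormalization transformations for
lattice gauge theories. II*, Commun. Math. Phys. **96** (1984) 223–250 [`Balaban1984PropagatorsII`, "B6"], p. 229 [PDF 7]
((2.36): «big blocks of the size ML^jη … each cube being a sum of 2^d big blocks»), p. 235 [PDF 13] (the enlarged cubes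
of (2.70)), p. 247 [PDF 25] ((2.133)–(2.136): the sums over `□ ∈ 𝒟`).  Unit `lit-balaban-p21` (Phase-2 proof seat p21
gen 17, file E4), HOME `run/shared/lean/pub/lit-balaban/`, B6 fold owner r03, referee ref-4.

## WHAT IS PRINTED (p. 229, p. 235, verbatim up to notation)

p. 229: «Let us divide each lattice (L^jη)ℤ^d into big blocks of the size ML^jη … we define the class 𝒟_j … of cubes
□ ⊂ B^j(Λ_j) … with a center y ∈ Λ_j and such that they are unions of the 2^d neighboring big blocks.»
p. 235: «we take a second cube □̃ containing □ in the middle and of the size 4M».  The finiteness of the overlap of the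
cubes (each point lies in boundedly many `□`, `□̃`) is used silently in every sum `Σ_{□∈𝒟}` of §2.B–§2.C ((2.70),
(2.82)–(2.85), (2.91)–(2.93), (2.133)–(2.136)).

## WHAT THIS FILE CERTIFIES (kernel-checked)

For every nested family `D : TDomains d ℓ M_h k P R` on the torus (`M_h ≥ 2`, `R ≥ 2L`, `P_μ ≥ 4`) and every torus
block `a ∈ 𝔅_T`: **`card_filter_mem_QT_le`** — `#{□ ∈ cubes : a ∈ QT □} ≤ 3·5^{d+1}`, where `QT □`
(`B6Partition118KLevelTorusCentralL0.QT`, p38) is the set of torus blocks of the enlarged cube `□⁺` (the blocks within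
`5S/4` of the centre of the central cube of `□`'s canonical chart, transported to the torus).  This is the displayed
hypothesis `hNov` of r03's (2.136)₁ assembly skeleton `B6Prop26KLevelSkeletonV1.prop26_2136_kLevel_skeleton` with
`Nov := 3·5^{d+1}`.  Route: a block of `□⁺` has level `j(□) − 1 … j(□) + 1` (`B6Cover236MultiLevelBlocksL0.window` in
the chart, `blkMap_fst`); a chart site `w` of it lies within `3S/2` of the chart centre (`mem_Q`, `dist_toR_cen_le`,
`pow_le_half_bigSide`); p38's congruence `tshift_sub_ctrT` transports «chart site − chart centre» to «torus site − torus
centre of `□`» modulo the period (`cubesEquiv_cc`: the central cube transports to `□`); two sites of `a` differ by less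
than `L^{j(a)} ≤ S/2`; hence `|x₀_μ − (β_μ + ½)S − N₀_μ·m| ≤ 2S` for a fixed site `x₀` of `a`, the label `β = □.2` of the
cube and an integer `m`, so `β_μ ≡ ⌊x₀_μ/S − ½⌋ + e_μ (mod P_j)` with `e_μ ∈ [−2, 2]` (`label_window`): at most `5`
labels per coordinate and `3` levels.

## HONEST SCOPE

A counting lemma about the cover, not a printed inequality; the constant `3·5^{d+1}` is ours (print: «O(1)» overlaps,
`2^d` big blocks per cube).  `M_h ≥ 2`, `R ≥ 2L`, `P_μ ≥ 4` as in p38's torus partition files.  Nothing is inferred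
from the manuscript: every step is kernel-checked.
-/

namespace Literature.MathematicalPhysics.QuantumFieldTheory.Balaban1983to89.B6Cover236MultiLevelTorusReachL0

open Finset
open Literature.MathematicalPhysics.QuantumFieldTheory.Balaban1983to89.B4Reflection242 (boxDom mem_boxDom blk)
open Literature.MathematicalPhysics.QuantumFieldTheory.Balaban1983to89.B6MultiLevelBoxOperator (N0 bigSide bigSide_eq one_le_bigSide)
open Literature.MathematicalPhysics.QuantumFieldTheory.Balaban1983to89.B6MultiLevelBoxOperatorL0 (Domains)
open Literature.MathematicalPhysics.QuantumFieldTheory.Balaban1983to89.B6MultiLevelTorusOperator (tshift)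
open Literature.MathematicalPhysics.QuantumFieldTheory.Balaban1983to89.B6MultiLevelTorusOperatorL0 (TDomains)
open Literature.MathematicalPhysics.QuantumFieldTheory.Balaban1983to89.B6Geom246MultiLevelBox (toR)
open Literature.MathematicalPhysics.QuantumFieldTheory.Balaban1983to89.B6Geom246MultiLevelBoxL0 (bset blkOf cen dist_toR_cen_le)
open Literature.MathematicalPhysics.QuantumFieldTheory.Balaban1983to89.B6Geom246MultiLevelTorusL0 (blkMap blkMap_blkOf)
open Literature.MathematicalPhysics.QuantumFieldTheory.Balaban1983to89.B6Cover236MultiLevelBlocksL0 (cubes side side_eq side_pos ctr Q mem_Q window proj blkOf_proj)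
open Literature.MathematicalPhysics.QuantumFieldTheory.Balaban1983to89.B6Eq238MultiLevelBox (Pj one_le_Pj)
open Literature.MathematicalPhysics.QuantumFieldTheory.Balaban1983to89.B6Eq238MultiLevelTorus (svec qc N0_eq_mul_Pj)
open Literature.MathematicalPhysics.QuantumFieldTheory.Balaban1983to89.B6Partition118KLevelTorusChart (cT)
open Literature.MathematicalPhysics.QuantumFieldTheory.Balaban1983to89.B6Partition118KLevelTorusChartL0 (cubesEquiv cubesEquiv_apply_val tshift_sub_ctrT label_mem_boxDom)
open Literature.MathematicalPhysics.QuantumFieldTheory.Balaban1983to89.B6Partition118KLevelTorusCentral (one_le_of_four_le pow_le_half_bigSide)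
open Literature.MathematicalPhysics.QuantumFieldTheory.Balaban1983to89.B6Partition118KLevelTorusCentralL0 (Dch σch cc side_cc cubesEquiv_cc QT level_bounds)
open Literature.MathematicalPhysics.QuantumFieldTheory.Balaban1983to89.B6Cover236MultiLevelTorusBlocksL0 (rep blkOf_rep blkMap_fst)

noncomputable section

variable {d : ℕ} {ℓ Mh k R : ℕ} {P : Fin (d + 1) → ℕ}

/-! ## §1 Arithmetic: an integer within `2` of a real lies in a window of `5` around its floor -/

/-- an integer `t` with `|u − t| ≤ 2` satisfies `⌊u⌋ − 2 ≤ t ≤ ⌊u⌋ + 2`. [folklore] -/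
private theorem label_window {u : ℝ} {t : ℤ} (h : |u - (t : ℝ)| ≤ 2) : -2 ≤ t - ⌊u⌋ ∧ t - ⌊u⌋ ≤ 2 := by
  have h1 := Int.floor_le u
  have h2 := Int.lt_floor_add_one u
  rw [abs_le] at h
  obtain ⟨hl, hr⟩ := h
  constructor
  · have : ((⌊u⌋ : ℤ) : ℝ) - 2 ≤ (t : ℝ) := by linarith
    have : ⌊u⌋ - 2 ≤ t := by exact_mod_cast this
    omega
  · by_contra hlt
    have : (⌊u⌋ : ℝ) + 3 ≤ (t : ℝ) := by exact_mod_cast (show ⌊u⌋ + 3 ≤ t by omega)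
    linarith

/-! ## §2 One cube: the level window and the label congruence of a reach set containing a block -/

section Reach

variable (D : TDomains d ℓ Mh k P R)

/-- two sites of the same block differ by less than the side of the block in every coordinate. [cite: Balaban1984PropagatorsII, (2.1) p.224, bookkeeping] -/
theorem abs_sub_le_of_blkOf_eq (D' : B6MultiLevelBoxOperatorL0.Domains d ℓ Mh k P R) {x x' : ↥(boxDom (N0 ℓ Mh k P))} {a : ↥(bset D')}
    (hx : blkOf D' x = a) (hx' : blkOf D' x' = a) (μ : Fin (d + 1)) :
    |(x.1 μ : ℝ) - (x'.1 μ : ℝ)| ≤ (((ℓ + 1) ^ a.1.1 : ℕ) : ℝ) - 1 := by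
  have h1 := dist_toR_cen_le D' hx
  have h2 := dist_toR_cen_le D' hx'
  have hμ : dist (toR x.1 μ) (toR x'.1 μ) ≤ dist (toR x.1) (toR x'.1) := dist_le_pi_dist _ _ μ
  have htri : dist (toR x.1) (toR x'.1) ≤ dist (toR x.1) (cen D' a) + dist (toR x'.1) (cen D' a) :=
    dist_triangle_right _ _ _
  have e : dist (toR x.1 μ) (toR x'.1 μ) = |(x.1 μ : ℝ) - (x'.1 μ : ℝ)| := Real.dist_eq _ _
  rw [← e]
  linarith

/-- **A BLOCK OF `□⁺` ON THE TORUS: THE LEVEL WINDOW AND THE LABEL CONGRUENCE.**  If the torus block `a` lies in the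
reach set `QT □` of the torus cube `□ = (j, β)`, then `j − 1 ≤ j(a) ≤ j + 1` and, for the representative site `x₀` of
`a`, in every coordinate `|x₀_μ − (β_μ + ½)S_j − N₀_μ·m| ≤ 2S_j` for some integer `m` (the reach `5S/4` of the central
cube read on the torus through the canonical chart of `□`). [cite: Balaban1984PropagatorsII, (2.36) p.229, p.235 (the enlarged cubes), dictionary (charts)] -/
theorem window_and_congr_of_mem_QT (hMh : 2 ≤ Mh) (hR : 2 * (ℓ + 1) ≤ R) (hMh1 : 1 ≤ Mh) (hP4 : ∀ μ, 4 ≤ P μ)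
    {c : ↥(B6Cover236MultiLevelBlocksL0.cubes D.toDomains)} {a : ↥(bset D.toDomains)} (ha : a ∈ QT D hMh1 hP4 c) :
    (c.1.1 ≤ a.1.1 + 1 ∧ a.1.1 ≤ c.1.1 + 1) ∧
    ∀ μ : Fin (d + 1), ∃ m : ℤ, |((rep D.toDomains a).1 μ : ℝ) - ((c.1.2 μ : ℝ) + 1 / 2) * (bigSide ℓ Mh c.1.1 : ℝ) -
      (N0 ℓ Mh k P μ : ℝ) * m| ≤ 2 * (bigSide ℓ Mh c.1.1 : ℝ) := by
  have hP : ∀ μ, 1 ≤ P μ := one_le_of_four_le hP4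
  unfold QT at ha
  rw [Finset.mem_image] at ha
  obtain ⟨b, hb, hba⟩ := ha
  -- the level window in the chart
  have hw := window (Dch D c) hMh1 hR hb
  have ecc1 : (cc D hMh1 hP4 c).1.1 = c.1.1 := rfl
  rw [ecc1] at hw
  have hab : b.1.1 = a.1.1 := by rw [← hba]; exact (blkMap_fst D hMh1 hP c b).symm
  rw [hab] at hw
  refine ⟨hw, fun μ => ?_⟩
  -- a chart site of the chart block, within `3S/2` of the chart centre
  obtain ⟨w, hwdef⟩ : ∃ w : ↥(boxDom (N0 ℓ Mh k P)), w = proj (Dch D c) b 0 := ⟨_, rfl⟩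
  have hwb : blkOf (Dch D c) w = b := by rw [hwdef]; exact blkOf_proj (Dch D c) b 0
  have h1 : dist (toR w.1) (cen (Dch D c) b) ≤ ((((ℓ + 1) ^ b.1.1 : ℕ) : ℝ) - 1) / 2 := dist_toR_cen_le (Dch D c) hwb
  have h2 : dist (cen (Dch D c) b) (ctr (Dch D c) (cc D hMh1 hP4 c)) ≤ 5 / 4 * (bigSide ℓ Mh c.1.1 : ℝ) :=
    (mem_Q (Dch D c)).1 hb
  have h3 : (((ℓ + 1) ^ b.1.1 : ℕ) : ℝ) ≤ (bigSide ℓ Mh c.1.1 : ℝ) / 2 :=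
    pow_le_half_bigSide (ℓ := ℓ) hMh (by omega)
  have hwc : |(w.1 μ : ℝ) - ctr (Dch D c) (cc D hMh1 hP4 c) μ| ≤ 3 / 2 * (bigSide ℓ Mh c.1.1 : ℝ) := by
    have hμ : dist (toR w.1 μ) (ctr (Dch D c) (cc D hMh1 hP4 c) μ) ≤ dist (toR w.1) (ctr (Dch D c) (cc D hMh1 hP4 c)) :=
      dist_le_pi_dist _ _ μ
    have htri : dist (toR w.1) (ctr (Dch D c) (cc D hMh1 hP4 c)) ≤
        dist (toR w.1) (cen (Dch D c) b) + dist (cen (Dch D c) b) (ctr (Dch D c) (cc D hMh1 hP4 c)) := dist_triangle _ _ _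
    have e : dist (toR w.1 μ) (ctr (Dch D c) (cc D hMh1 hP4 c) μ) = |(w.1 μ : ℝ) - ctr (Dch D c) (cc D hMh1 hP4 c) μ| :=
      Real.dist_eq _ _
    rw [← e]
    linarith
  -- the congruence «torus site − torus centre ≡ chart site − chart centre (mod N₀)»
  have hjk : (cc D hMh1 hP4 c).1.1 ≤ k := (level_bounds D.toDomains c).2
  obtain ⟨m, hm⟩ := tshift_sub_ctrT (svec ℓ k c.1.1 c.1.2) (c := (cc D hMh1 hP4 c).1) hjk w μ
  have hcT : cT ℓ k P (svec ℓ k c.1.1 c.1.2) (cc D hMh1 hP4 c).1 = c.1 := by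
    have h := congrArg Subtype.val (cubesEquiv_cc (D := D) hMh1 hP4 c)
    rwa [cubesEquiv_apply_val] at h
  rw [hcT] at hm
  have ectr : ctr (Dch D c) (cc D hMh1 hP4 c) μ = (((cc D hMh1 hP4 c).1.2 μ : ℝ) + 1 / 2) * (bigSide ℓ Mh c.1.1 : ℝ) := rfl
  rw [ectr] at hwc
  -- the torus site `x = σ_c w` lies in the block `a`
  obtain ⟨x, hxdef⟩ : ∃ x : ↥(boxDom (N0 ℓ Mh k P)), x = σch D c w := ⟨_, rfl⟩
  have hxa : blkOf D.toDomains x = a := by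
    rw [hxdef, ← hba, ← hwb]
    exact (blkMap_blkOf hMh1 hP (svec ℓ k c.1.1 c.1.2) w).symm
  have hm' : (x.1 μ : ℝ) - ((c.1.2 μ : ℝ) + 1 / 2) * (bigSide ℓ Mh c.1.1 : ℝ) =
      ((w.1 μ : ℝ) - (((cc D hMh1 hP4 c).1.2 μ : ℝ) + 1 / 2) * (bigSide ℓ Mh c.1.1 : ℝ)) + (N0 ℓ Mh k P μ : ℝ) * m := by
    rw [hxdef]; exact hm
  -- two sites of `a` differ by less than `L^{j(a)} ≤ S/2`
  have hxx : |(x.1 μ : ℝ) - ((rep D.toDomains a).1 μ : ℝ)| ≤ (((ℓ + 1) ^ a.1.1 : ℕ) : ℝ) - 1 :=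
    abs_sub_le_of_blkOf_eq D.toDomains hxa (blkOf_rep D.toDomains a) μ
  have h4 : (((ℓ + 1) ^ a.1.1 : ℕ) : ℝ) ≤ (bigSide ℓ Mh c.1.1 : ℝ) / 2 := pow_le_half_bigSide (ℓ := ℓ) hMh hw.2
  refine ⟨m, ?_⟩
  rw [abs_le] at hwc hxx ⊢
  obtain ⟨hwc1, hwc2⟩ := hwc
  obtain ⟨hxx1, hxx2⟩ := hxx
  constructor <;> linarith

end Reach

/-! ## §3 The count: at most `3·5^{d+1}` enlarged cubes contain a given torus block -/

section Count

variable (D : TDomains d ℓ Mh k P R)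

/-- **FINITE OVERLAP OF THE REACH SETS `□⁺` ON THE TORUS** (r03's binder `hNov` with `Nov = 3·5^{d+1}`): every torus
block lies in at most `3·5^{d+1}` of the sets `QT □` (three levels, five labels per coordinate). [cite: Balaban1984PropagatorsII, (2.36) p.229 («each cube being a sum of 2^d big blocks»), p.235, bookkeeping] -/
theorem card_filter_mem_QT_le (hMh : 2 ≤ Mh) (hR : 2 * (ℓ + 1) ≤ R) (hMh1 : 1 ≤ Mh) (hP4 : ∀ μ, 4 ≤ P μ)
    (a : ↥(B6Geom246MultiLevelBoxL0.bset D.toDomains)) :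
    #(Finset.univ.filter fun c : ↥(cubes D.toDomains) => a ∈ QT D hMh1 hP4 c) ≤ 3 * 5 ^ (d + 1) := by
  classical
  have hP : ∀ μ, 1 ≤ P μ := one_le_of_four_le hP4
  obtain ⟨x₀, hx₀⟩ : ∃ x₀ : ↥(boxDom (N0 ℓ Mh k P)), x₀ = rep D.toDomains a := ⟨_, rfl⟩
  obtain ⟨u, hu⟩ : ∃ u : ℕ → Fin (d + 1) → ℤ,
      u = fun j μ => ⌊(x₀.1 μ : ℝ) / (bigSide ℓ Mh j : ℝ) - 1 / 2⌋ := ⟨_, rfl⟩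
  obtain ⟨T, hT⟩ : ∃ T : Finset (ℕ × (Fin (d + 1) → ℤ)), T = (Finset.Icc (a.1.1 - 1) (a.1.1 + 1)).biUnion
      fun j => (Fintype.piFinset fun _ : Fin (d + 1) => Finset.Icc (-2 : ℤ) 2).image
        fun e => (j, fun μ => (u j μ + e μ) % (Pj ℓ k P j μ : ℤ)) := ⟨_, rfl⟩
  have h5 : #(Finset.Icc (-2 : ℤ) 2) = 5 := by rw [Int.card_Icc]; rfl
  have hT3 : #T ≤ 3 * 5 ^ (d + 1) := by
    rw [hT]
    refine Finset.card_biUnion_le.trans ?_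
    calc ∑ j ∈ Finset.Icc (a.1.1 - 1) (a.1.1 + 1),
          #((Fintype.piFinset fun _ : Fin (d + 1) => Finset.Icc (-2 : ℤ) 2).image
            fun e => (j, fun μ => (u j μ + e μ) % (Pj ℓ k P j μ : ℤ)))
        ≤ ∑ _j ∈ Finset.Icc (a.1.1 - 1) (a.1.1 + 1), 5 ^ (d + 1) := Finset.sum_le_sum fun j _ => by
          refine Finset.card_image_le.trans (le_of_eq ?_)
          rw [Fintype.card_piFinset_const, h5]
      _ = #(Finset.Icc (a.1.1 - 1) (a.1.1 + 1)) * 5 ^ (d + 1) := by rw [Finset.sum_const, smul_eq_mul]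
      _ ≤ 3 * 5 ^ (d + 1) := by rw [Nat.card_Icc]; exact Nat.mul_le_mul_right _ (by omega)
  have hsub : (Finset.univ.filter fun c : ↥(cubes D.toDomains) => a ∈ QT D hMh1 hP4 c).map
      ⟨Subtype.val, Subtype.val_injective⟩ ⊆ T := by
    intro cv hc
    rw [Finset.mem_map] at hc
    obtain ⟨c, hc, rfl⟩ := hc
    have ha := (Finset.mem_filter.1 hc).2
    obtain ⟨hwin, hcong⟩ := window_and_congr_of_mem_QT D hMh hR hMh1 hP4 ha
    choose m hm using hcong
    have hjk : c.1.1 ≤ k := (level_bounds D.toDomains c).2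
    have hS : 0 < (bigSide ℓ Mh c.1.1 : ℝ) := Nat.cast_pos.2 (one_le_bigSide hMh1 _)
    have hlab := mem_boxDom.1 (label_mem_boxDom D.toDomains hMh1 c.2)
    have hN : ∀ μ, (N0 ℓ Mh k P μ : ℝ) = (bigSide ℓ Mh c.1.1 : ℝ) * (Pj ℓ k P c.1.1 μ : ℝ) := fun μ => by
      rw [N0_eq_mul_Pj hjk μ, bigSide_eq]; push_cast; ring
    -- per coordinate: the label is `⌊x₀_μ/S − ½⌋ + e (mod P_j)` with `|e| ≤ 2`
    have hwin' : ∀ μ, -2 ≤ c.1.2 μ + (Pj ℓ k P c.1.1 μ : ℤ) * m μ - u c.1.1 μ ∧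
        c.1.2 μ + (Pj ℓ k P c.1.1 μ : ℤ) * m μ - u c.1.1 μ ≤ 2 := by
      intro μ
      rw [hu]
      refine label_window ?_
      have h := hm μ
      rw [← hx₀, hN μ] at h
      have e : (x₀.1 μ : ℝ) / (bigSide ℓ Mh c.1.1 : ℝ) - 1 / 2 - ((c.1.2 μ + (Pj ℓ k P c.1.1 μ : ℤ) * m μ : ℤ) : ℝ) =
          ((x₀.1 μ : ℝ) - ((c.1.2 μ : ℝ) + 1 / 2) * (bigSide ℓ Mh c.1.1 : ℝ) -
            (bigSide ℓ Mh c.1.1 : ℝ) * (Pj ℓ k P c.1.1 μ : ℝ) * (m μ)) / (bigSide ℓ Mh c.1.1 : ℝ) := by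
        push_cast; field_simp; ring
      rw [e, abs_div, abs_of_pos hS, div_le_iff₀ hS]
      exact h
    rw [hT, Finset.mem_biUnion]
    refine ⟨c.1.1, by rw [Finset.mem_Icc]; omega, ?_⟩
    rw [Finset.mem_image]
    refine ⟨fun μ => c.1.2 μ + (Pj ℓ k P c.1.1 μ : ℤ) * m μ - u c.1.1 μ, ?_, ?_⟩
    · rw [Fintype.mem_piFinset]; intro μ; rw [Finset.mem_Icc]; exact hwin' μ
    · show (c.1.1, fun μ => (u c.1.1 μ + (c.1.2 μ + (Pj ℓ k P c.1.1 μ : ℤ) * m μ - u c.1.1 μ)) % (Pj ℓ k P c.1.1 μ : ℤ))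
        = c.1
      refine Prod.ext rfl (funext fun μ => ?_)
      show (u c.1.1 μ + (c.1.2 μ + (Pj ℓ k P c.1.1 μ : ℤ) * m μ - u c.1.1 μ)) % (Pj ℓ k P c.1.1 μ : ℤ) = c.1.2 μ
      have e : u c.1.1 μ + (c.1.2 μ + (Pj ℓ k P c.1.1 μ : ℤ) * m μ - u c.1.1 μ) =
          c.1.2 μ + (Pj ℓ k P c.1.1 μ : ℤ) * m μ := by ring
      rw [e, Int.add_mul_emod_self_left]
      exact Int.emod_eq_of_lt (hlab μ).1 (hlab μ).2
  calc #(Finset.univ.filter fun c : ↥(cubes D.toDomains) => a ∈ QT D hMh1 hP4 c)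
      = #((Finset.univ.filter fun c : ↥(cubes D.toDomains) => a ∈ QT D hMh1 hP4 c).map
          ⟨Subtype.val, Subtype.val_injective⟩) := (Finset.card_map _).symm
    _ ≤ #T := Finset.card_le_card hsub
    _ ≤ 3 * 5 ^ (d + 1) := hT3

end Count

end

end Literature.MathematicalPhysics.QuantumFieldTheory.Balaban1983to89.B6Cover236MultiLevelTorusReachL0
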